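import Summits.CriticalPhenomena.PercolationContinuityZ3.Theorems.PercNearOneGluingNoHeavyLowerTailFourPointFaceDefs
import Mathlib.Data.Real.Basic
import Mathlib.Tactic.Ring
import Mathlib.Tactic.Linarith
import Mathlib.Tactic.Positivity
import HarnessLib

/-!
# `NoHeavyLowerTail` (stmt-CriticalPhenomena-4575) — (L1)/(L2) face-first, part 2: the pendant-`c` and pendant-`b` pencils are QUADRATIC
# with a HARRIS middle coefficient (first-order form at the `c`-isolated stratum of the cut-vertex face)

Support file (prover prim-l12-p6, line P6; `--supports stmt-CriticalPhenomena-4575`).  Pure algebra (`ring`) and elementary sign arguments; no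
sorries, no named facts, no new definitions (forms `polL₁`, `polL₂`, `hybE₁`, `hybE₂`, `Hh` of `…FourPointFaceDefs`, 15 cell variables in
the binder order of `CubicThreePointStep.threeB₁_polarization`).

THE PENCIL.  Let `x` be any 15-cell law of `(a,b,c,y)` and `x⁰⁰` its `c`-ISOLATED projection (marginalise `c`, then put `c` in a singleton
block: `x⁰⁰(π ∪ {c}) = Σ_(cells restricting to π)`, all cells with `c` joined to something are `0`).  The pencil `x_ε = (1−ε)·x⁰⁰ + ε·x`,
`ε ∈ [0,1]`, is EXACTLY the family of four-point laws of the graphs in which `c` hangs off a cut vertex `v`: `x` = law of `(a,b,v,y)` with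
`v` renamed `c` (i.e. of `G/{c = v}`), `ε = P(c ~ v inside the hanging block)` (for a pendant edge, `ε` = its weight).  Along it the cubic
forms are only QUADRATIC in `ε`, with NO new four-point ingredient:
* `polL₁_pendant_c`:  `polL₁(x_ε) = ε(1−ε)·σ·[Hh(D[ab|c], G_ab) + Hh(D[aby|c], D_ab)] + ε²·polL₁(x)`,
* `polL₂_pendant_c`:  `polL₂(x_ε) = ε(1−ε)·σ·[Hh(G_ab, D[aby|c]) + Hh(D[ab|c], G_ab) + Hh(D[aby|c], D_ab)] + ε²·polL₂(x)`,
* `hybE₁_pendant_c`:  `hybE₁(x_ε) = ε(1−ε)·σ·Hh(D[ab|c], G_ab) + ε²·hybE₁(x)`,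
* `hybE₂_pendant_c`:  `hybE₂(x_ε) = ε(1−ε)·(σ·Hh(D[aby|c], D_ab) + σ²·«a|bcy») + ε²·hybE₂(x)`,
where `D[ab|c] = D_bc ∩ D_ac` ("`c` separated from `a` and `b`"), `D[aby|c] = D_bc ∩ D[ay|c]`, `G_ab = D[ay|b]`, and `Hh(σ; U, V; U∩V) =
σ·m(U∩V) − m(U)·m(V)` is the Harris form of two DECREASING events (nonnegative on every realizable law by Harris–FKG).  The middle coefficients
are the first-order (normal-derivative) forms of (L1),(L2),(E1),(E2) at the `c`-isolated stratum of the cut-vertex face in realizable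
directions; the top coefficients are the forms themselves at the contracted law.  By the `b ↔ c` symmetry (`polL₁_swap_bc`) the same holds for the
pendant-`b` pencil (`polL₁_pendant_b`, stated explicitly).
CONSEQUENCES (`*_nonneg`): hanging `c` (or `b`) behind a cut vertex PRESERVES (L1), (L2), (E1), (E2) given only Harris — so in any inductive
proof one may assume w.l.o.g. that neither `b` nor `c` is separated from the other three terminals by a cut vertex (the pendant-`y` pencil is
affine and needs only SHK3⁺, prim-l12-p2 `HybMasses.L1_cells_pendant_y`; the pendant-`a` pencil is the genuinely four-point one).
Found by exact computer algebra (seat prim-l12-p6, work/py/pencils.py), re-proved here by `ring`.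
[cite: GladkovZimin2024HK, §4 (one-coordinate / block decomposition; the forms are this programme's)]
-/

namespace Summit.CriticalPhenomena.PercolationContinuityZ3.Theorems

namespace CubicFourPoint

variable {R : Type*} [CommRing R]

set_option maxRecDepth 10000 in
set_option maxHeartbeats 1600000 in
/-- **Pendant-`c` pencil of (L1)**: `polL₁((1−ε)x⁰⁰ + εx) = ε(1−ε)·σ·[Hh(D[ab|c],G_ab) + Hh(D[aby|c],D_ab)] + ε²·polL₁(x)`
(`x⁰⁰` = `c`-isolated projection of `x`; polynomial identity in the 15 cells and `ε`). [this work] -/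
theorem polL₁_pendant_c («a|b|c|y» «a|b|cy» «a|by|c» «a|bc|y» «ay|b|c» «ac|b|y» «ab|c|y» «a|bcy» «ay|bc» «ac|by» «acy|b» «ab|cy» «aby|c» «abc|y» «abcy» ε : R) :
    polL₁ ((1 - ε) * («a|b|c|y» + «a|b|cy» + «a|bc|y» + «ac|b|y») + ε * «a|b|c|y») (ε * «a|b|cy») ((1 - ε) * («a|by|c» + «a|bcy» + «ac|by») + ε * «a|by|c») (ε * «a|bc|y») ((1 - ε) * («ay|b|c» + «ay|bc» + «acy|b») + ε * «ay|b|c») (ε * «ac|b|y») ((1 - ε) * («ab|c|y» + «ab|cy» + «abc|y») + ε * «ab|c|y») (ε * «a|bcy») (ε * «ay|bc») (ε * «ac|by») (ε * «acy|b») (ε * «ab|cy») ((1 - ε) * («aby|c» + «abcy») + ε * «aby|c») (ε * «abc|y») (ε * «abcy»)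
      = ε * (1 - ε) * ((«a|b|c|y» + «a|b|cy» + «a|by|c» + «a|bc|y» + «ay|b|c» + «ac|b|y» + «ab|c|y» + «a|bcy» + «ay|bc» + «ac|by» + «acy|b» + «ab|cy» + «aby|c» + «abc|y» + «abcy») * (Hh («a|b|c|y» + «a|b|cy» + «a|by|c» + «a|bc|y» + «ay|b|c» + «ac|b|y» + «ab|c|y» + «a|bcy» + «ay|bc» + «ac|by» + «acy|b» + «ab|cy» + «aby|c» + «abc|y» + «abcy») («a|b|c|y» + «a|b|cy» + «a|by|c» + «ay|b|c» + «ab|c|y» + «ab|cy» + «aby|c») («a|b|c|y» + «a|b|cy» + «a|bc|y» + «ay|b|c» + «ac|b|y» + «ay|bc» + «acy|b») («a|b|c|y» + «a|b|cy» + «ay|b|c») + Hh («a|b|c|y» + «a|b|cy» + «a|by|c» + «a|bc|y» + «ay|b|c» + «ac|b|y» + «ab|c|y» + «a|bcy» + «ay|bc» + «ac|by» + «acy|b» + «ab|cy» + «aby|c» + «abc|y» + «abcy») («a|b|c|y» + «a|by|c» + «ay|b|c» + «ab|c|y» + «aby|c») («a|b|c|y» + «a|b|cy» + «a|by|c» +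 «a|bc|y» + «ay|b|c» + «ac|b|y» + «a|bcy» + «ay|bc» + «ac|by» + «acy|b») («a|b|c|y» + «a|by|c» + «ay|b|c»)))
        + ε ^ 2 * polL₁ «a|b|c|y» «a|b|cy» «a|by|c» «a|bc|y» «ay|b|c» «ac|b|y» «ab|c|y» «a|bcy» «ay|bc» «ac|by» «acy|b» «ab|cy» «aby|c» «abc|y» «abcy» := by
  simp only [polL₁, hybE₁, hybE₂, E3h, Hh]
  ring

set_option maxRecDepth 10000 in
set_option maxHeartbeats 1600000 in
/-- **Pendant-`c` pencil of (L2)**: `polL₂((1−ε)x⁰⁰ + εx) = ε(1−ε)·σ·[Hh(G_ab,D[aby|c]) + Hh(D[ab|c],G_ab) + Hh(D[aby|c],D_ab)] + ε²·polL₂(x)`.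
[this work] -/
theorem polL₂_pendant_c («a|b|c|y» «a|b|cy» «a|by|c» «a|bc|y» «ay|b|c» «ac|b|y» «ab|c|y» «a|bcy» «ay|bc» «ac|by» «acy|b» «ab|cy» «aby|c» «abc|y» «abcy» ε : R) :
    polL₂ ((1 - ε) * («a|b|c|y» + «a|b|cy» + «a|bc|y» + «ac|b|y») + ε * «a|b|c|y») (ε * «a|b|cy») ((1 - ε) * («a|by|c» + «a|bcy» + «ac|by») + ε * «a|by|c») (ε * «a|bc|y») ((1 - ε) * («ay|b|c» + «ay|bc» + «acy|b») + ε * «ay|b|c») (ε * «ac|b|y») ((1 - ε) * («ab|c|y» + «ab|cy» + «abc|y») + ε * «ab|c|y») (ε * «a|bcy») (ε * «ay|bc») (ε * «ac|by») (ε * «acy|b») (ε * «ab|cy») ((1 - ε) * («aby|c» + «abcy») + ε * «aby|c») (ε * «abc|y») (ε * «abcy»)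
      = ε * (1 - ε) * ((«a|b|c|y» + «a|b|cy» + «a|by|c» + «a|bc|y» + «ay|b|c» + «ac|b|y» + «ab|c|y» + «a|bcy» + «ay|bc» + «ac|by» + «acy|b» + «ab|cy» + «aby|c» + «abc|y» + «abcy») * (Hh («a|b|c|y» + «a|b|cy» + «a|by|c» + «a|bc|y» + «ay|b|c» + «ac|b|y» + «ab|c|y» + «a|bcy» + «ay|bc» + «ac|by» + «acy|b» + «ab|cy» + «aby|c» + «abc|y» + «abcy») («a|b|c|y» + «a|b|cy» + «a|bc|y» + «ay|b|c» + «ac|b|y» + «ay|bc» + «acy|b») («a|b|c|y» + «a|by|c» + «ay|b|c» + «ab|c|y» + «aby|c») («a|b|c|y» + «ay|b|c») + Hh («a|b|c|y» + «a|b|cy» + «a|by|c» + «a|bc|y» + «ay|b|c» + «ac|b|y» + «ab|c|y» + «a|bcy» + «ay|bc» + «ac|by» + «acy|b» + «ab|cy» + «aby|c» + «abc|y» + «abcy») («a|b|c|y» + «a|b|cy» + «a|by|c» + «ay|b|c» + «ab|c|y» + «ab|cy» + «aby|c») («a|b|c|y» + «a|b|cy» + «a|bc|y» + «ay|b|c»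 + «ac|b|y» + «ay|bc» + «acy|b») («a|b|c|y» + «a|b|cy» + «ay|b|c») + Hh («a|b|c|y» + «a|b|cy» + «a|by|c» + «a|bc|y» + «ay|b|c» + «ac|b|y» + «ab|c|y» + «a|bcy» + «ay|bc» + «ac|by» + «acy|b» + «ab|cy» + «aby|c» + «abc|y» + «abcy») («a|b|c|y» + «a|by|c» + «ay|b|c» + «ab|c|y» + «aby|c») («a|b|c|y» + «a|b|cy» + «a|by|c» + «a|bc|y» + «ay|b|c» + «ac|b|y» + «a|bcy» + «ay|bc» + «ac|by» + «acy|b») («a|b|c|y» + «a|by|c» + «ay|b|c»)))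
        + ε ^ 2 * polL₂ «a|b|c|y» «a|b|cy» «a|by|c» «a|bc|y» «ay|b|c» «ac|b|y» «ab|c|y» «a|bcy» «ay|bc» «ac|by» «acy|b» «ab|cy» «aby|c» «abc|y» «abcy» := by
  simp only [polL₂, hybE₁, hybE₂, hybE₃g, E3h, Hh]
  ring

set_option maxRecDepth 10000 in
set_option maxHeartbeats 1600000 in
/-- **Pendant-`c` pencil of the hybrid row (E1)**: `hybE₁((1−ε)x⁰⁰ + εx) = ε(1−ε)·σ·Hh(D[ab|c],G_ab) + ε²·hybE₁(x)`. [this work] -/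
theorem hybE₁_pendant_c («a|b|c|y» «a|b|cy» «a|by|c» «a|bc|y» «ay|b|c» «ac|b|y» «ab|c|y» «a|bcy» «ay|bc» «ac|by» «acy|b» «ab|cy» «aby|c» «abc|y» «abcy» ε : R) :
    hybE₁ ((1 - ε) * («a|b|c|y» + «a|b|cy» + «a|bc|y» + «ac|b|y») + ε * «a|b|c|y») (ε * «a|b|cy») ((1 - ε) * («a|by|c» + «a|bcy» + «ac|by») + ε * «a|by|c») (ε * «a|bc|y») ((1 - ε) * («ay|b|c» + «ay|bc» + «acy|b») + ε * «ay|b|c») (ε * «ac|b|y») ((1 - ε) * («ab|c|y» + «ab|cy» + «abc|y») + ε * «ab|c|y») (ε * «a|bcy») (ε * «ay|bc») (ε * «ac|by») (ε * «acy|b») (ε * «ab|cy») ((1 - ε) * («aby|c» + «abcy») + ε * «aby|c») (ε * «abc|y») (ε * «abcy»)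
      = ε * (1 - ε) * ((«a|b|c|y» + «a|b|cy» + «a|by|c» + «a|bc|y» + «ay|b|c» + «ac|b|y» + «ab|c|y» + «a|bcy» + «ay|bc» + «ac|by» + «acy|b» + «ab|cy» + «aby|c» + «abc|y» + «abcy») * Hh («a|b|c|y» + «a|b|cy» + «a|by|c» + «a|bc|y» + «ay|b|c» + «ac|b|y» + «ab|c|y» + «a|bcy» + «ay|bc» + «ac|by» + «acy|b» + «ab|cy» + «aby|c» + «abc|y» + «abcy») («a|b|c|y» + «a|b|cy» + «a|by|c» + «ay|b|c» + «ab|c|y» + «ab|cy» + «aby|c») («a|b|c|y» + «a|b|cy» + «a|bc|y» + «ay|b|c» + «ac|b|y» + «ay|bc» + «acy|b») («a|b|c|y» + «a|b|cy» + «ay|b|c»))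
        + ε ^ 2 * hybE₁ «a|b|c|y» «a|b|cy» «a|by|c» «a|bc|y» «ay|b|c» «ac|b|y» «ab|c|y» «a|bcy» «ay|bc» «ac|by» «acy|b» «ab|cy» «aby|c» «abc|y» «abcy» := by
  simp only [hybE₁, E3h, Hh]
  ring

set_option maxRecDepth 10000 in
set_option maxHeartbeats 1600000 in
/-- **Pendant-`c` pencil of the mirror row (E2)**: `hybE₂((1−ε)x⁰⁰ + εx) = ε(1−ε)·(σ·Hh(D[aby|c],D_ab) + σ²·«a|bcy») + ε²·hybE₂(x)`.
[this work] -/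
theorem hybE₂_pendant_c («a|b|c|y» «a|b|cy» «a|by|c» «a|bc|y» «ay|b|c» «ac|b|y» «ab|c|y» «a|bcy» «ay|bc» «ac|by» «acy|b» «ab|cy» «aby|c» «abc|y» «abcy» ε : R) :
    hybE₂ ((1 - ε) * («a|b|c|y» + «a|b|cy» + «a|bc|y» + «ac|b|y») + ε * «a|b|c|y») (ε * «a|b|cy») ((1 - ε) * («a|by|c» + «a|bcy» + «ac|by») + ε * «a|by|c») (ε * «a|bc|y») ((1 - ε) * («ay|b|c» + «ay|bc» + «acy|b») + ε * «ay|b|c») (ε * «ac|b|y») ((1 - ε) * («ab|c|y» + «ab|cy» + «abc|y») + ε * «ab|c|y») (ε * «a|bcy») (ε * «ay|bc») (ε * «ac|by») (ε * «acy|b») (ε * «ab|cy») ((1 - ε) * («aby|c» + «abcy») + ε * «aby|c») (ε * «abc|y») (ε * «abcy»)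
      = ε * (1 - ε) * ((«a|b|c|y» + «a|b|cy» + «a|by|c» + «a|bc|y» + «ay|b|c» + «ac|b|y» + «ab|c|y» + «a|bcy» + «ay|bc» + «ac|by» + «acy|b» + «ab|cy» + «aby|c» + «abc|y» + «abcy») * Hh («a|b|c|y» + «a|b|cy» + «a|by|c» + «a|bc|y» + «ay|b|c» + «ac|b|y» + «ab|c|y» + «a|bcy» + «ay|bc» + «ac|by» + «acy|b» + «ab|cy» + «aby|c» + «abc|y» + «abcy») («a|b|c|y» + «a|by|c» + «ay|b|c» + «ab|c|y» + «aby|c») («a|b|c|y» + «a|b|cy» + «a|by|c» + «a|bc|y» + «ay|b|c» + «ac|b|y» + «a|bcy» + «ay|bc» + «ac|by» + «acy|b») («a|b|c|y» + «a|by|c» + «ay|b|c») + («a|b|c|y» + «a|b|cy» + «a|by|c» + «a|bc|y» + «ay|b|c» + «ac|b|y» + «ab|c|y» + «a|bcy» + «ay|bc» + «ac|by» + «acy|b» + «ab|cy» + «aby|c» + «abc|y» + «abcy») ^ 2 * «a|bcy»)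
        + ε ^ 2 * hybE₂ «a|b|c|y» «a|b|cy» «a|by|c» «a|bc|y» «ay|b|c» «ac|b|y» «ab|c|y» «a|bcy» «ay|bc» «ac|by» «acy|b» «ab|cy» «aby|c» «abc|y» «abcy» := by
  simp only [hybE₂, E3h, Hh]
  ring

set_option maxRecDepth 10000 in
set_option maxHeartbeats 1600000 in
/-- **Pendant-`b` pencil of (L1)** (the `b ↔ c` mirror): with `x⁰ᵇ` the `b`-isolated projection,
`polL₁((1−ε)x⁰ᵇ + εx) = ε(1−ε)·σ·[Hh(D[ac|b], D[ay|c]) + Hh(D[acy|b], D_ac)] + ε²·polL₁(x)`. [this work] -/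
theorem polL₁_pendant_b («a|b|c|y» «a|b|cy» «a|by|c» «a|bc|y» «ay|b|c» «ac|b|y» «ab|c|y» «a|bcy» «ay|bc» «ac|by» «acy|b» «ab|cy» «aby|c» «abc|y» «abcy» ε : R) :
    polL₁ ((1 - ε) * («a|b|c|y» + «a|by|c» + «a|bc|y» + «ab|c|y») + ε * «a|b|c|y») ((1 - ε) * («a|b|cy» + «a|bcy» + «ab|cy») + ε * «a|b|cy») (ε * «a|by|c») (ε * «a|bc|y») ((1 - ε) * («ay|b|c» + «ay|bc» + «aby|c») + ε * «ay|b|c») ((1 - ε) * («ac|b|y» + «ac|by» + «abc|y») + ε * «ac|b|y») (ε * «ab|c|y») (ε * «a|bcy») (ε * «ay|bc») (ε * «ac|by») ((1 - ε) * («acy|b» + «abcy») + ε * «acy|b») (ε * «ab|cy») (ε * «aby|c») (ε * «abc|y») (ε * «abcy»)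
      = ε * (1 - ε) * ((«a|b|c|y» + «a|b|cy» + «a|by|c» + «a|bc|y» + «ay|b|c» + «ac|b|y» + «ab|c|y» + «a|bcy» + «ay|bc» + «ac|by» + «acy|b» + «ab|cy» + «aby|c» + «abc|y» + «abcy») * (Hh («a|b|c|y» + «a|b|cy» + «a|by|c» + «a|bc|y» + «ay|b|c» + «ac|b|y» + «ab|c|y» + «a|bcy» + «ay|bc» + «ac|by» + «acy|b» + «ab|cy» + «aby|c» + «abc|y» + «abcy») («a|b|c|y» + «a|b|cy» + «a|by|c» + «ay|b|c» + «ac|b|y» + «ac|by» + «acy|b») («a|b|c|y» + «a|by|c» + «a|bc|y» + «ay|b|c» + «ab|c|y» + «ay|bc» + «aby|c») («a|b|c|y» + «a|by|c» + «ay|b|c») + Hh («a|b|c|y» + «a|b|cy» + «a|by|c» + «a|bc|y» + «ay|b|c» + «ac|b|y» + «ab|c|y» + «a|bcy» + «ay|bc» + «ac|by» + «acy|b» + «ab|cy» + «aby|c» + «abc|y» + «abcy») («a|b|c|y» + «a|b|cy» + «ay|b|c» + «ac|b|y» + «acy|b») («a|b|c|y» + «a|b|cy» + «a|by|c» + «a|bc|y»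 + «ay|b|c» + «ab|c|y» + «a|bcy» + «ay|bc» + «ab|cy» + «aby|c») («a|b|c|y» + «a|b|cy» + «ay|b|c»)))
        + ε ^ 2 * polL₁ «a|b|c|y» «a|b|cy» «a|by|c» «a|bc|y» «ay|b|c» «ac|b|y» «ab|c|y» «a|bcy» «ay|bc» «ac|by» «acy|b» «ab|cy» «aby|c» «abc|y» «abcy» := by
  simp only [polL₁, hybE₁, hybE₂, E3h, Hh]
  ring

/-! ### Sign consequences over `ℝ` -/

/-- A quadratic pencil `ε(1−ε)·M + ε²·T` with `M, T ≥ 0` is nonnegative on `[0,1]`. [folklore] -/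
theorem pencil_nonneg {M T ε : ℝ} (hM : 0 ≤ M) (hT : 0 ≤ T) (h0 : 0 ≤ ε) (h1 : ε ≤ 1) :
    0 ≤ ε * (1 - ε) * M + ε ^ 2 * T := by
  have h1' : 0 ≤ 1 - ε := by linarith
  positivity

/-- **Hanging `c` behind a cut vertex preserves (L1)** given Harris: if the two Harris forms `Hh(D[ab|c],G_ab)`, `Hh(D[aby|c],D_ab)` of the
contracted law `x` are `≥ 0`, its total mass is `≥ 0`, and `polL₁(x) ≥ 0`, then `polL₁ ≥ 0` along the whole pendant-`c` pencil. [this work] -/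
theorem polL₁_pendant_c_nonneg {«a|b|c|y» «a|b|cy» «a|by|c» «a|bc|y» «ay|b|c» «ac|b|y» «ab|c|y» «a|bcy» «ay|bc» «ac|by» «acy|b» «ab|cy» «aby|c» «abc|y» «abcy» ε : ℝ}
    (hσ : 0 ≤ («a|b|c|y» + «a|b|cy» + «a|by|c» + «a|bc|y» + «ay|b|c» + «ac|b|y» + «ab|c|y» + «a|bcy» + «ay|bc» + «ac|by» + «acy|b» + «ab|cy» + «aby|c» + «abc|y» + «abcy»))
    (hH₁ : 0 ≤ Hh («a|b|c|y» + «a|b|cy» + «a|by|c» + «a|bc|y» + «ay|b|c» + «ac|b|y» + «ab|c|y» + «a|bcy» + «ay|bc» + «ac|by» + «acy|b» + «ab|cy» + «aby|c» + «abc|y» + «abcy») («a|b|c|y» + «a|b|cy» + «a|by|c» + «ay|b|c» + «ab|c|y» + «ab|cy» + «aby|c») («a|b|c|y» + «a|b|cy» + «a|bc|y» + «ay|b|c» + «ac|b|y» + «ay|bc» + «acy|b») («a|b|c|y» + «a|b|cy» + «ay|b|c»))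
    (hH₂ : 0 ≤ Hh («a|b|c|y» + «a|b|cy» + «a|by|c» + «a|bc|y» + «ay|b|c» + «ac|b|y» + «ab|c|y» + «a|bcy» + «ay|bc» + «ac|by» + «acy|b» + «ab|cy» + «aby|c» + «abc|y» + «abcy») («a|b|c|y» + «a|by|c» + «ay|b|c» + «ab|c|y» + «aby|c») («a|b|c|y» + «a|b|cy» + «a|by|c» + «a|bc|y» + «ay|b|c» + «ac|b|y» + «a|bcy» + «ay|bc» + «ac|by» + «acy|b») («a|b|c|y» + «a|by|c» + «ay|b|c»))
    (hx : 0 ≤ polL₁ «a|b|c|y» «a|b|cy» «a|by|c» «a|bc|y» «ay|b|c» «ac|b|y» «ab|c|y» «a|bcy» «ay|bc» «ac|by» «acy|b» «ab|cy» «aby|c» «abc|y» «abcy») (h0 : 0 ≤ ε) (h1 : ε ≤ 1) :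
    0 ≤ polL₁ ((1 - ε) * («a|b|c|y» + «a|b|cy» + «a|bc|y» + «ac|b|y») + ε * «a|b|c|y») (ε * «a|b|cy») ((1 - ε) * («a|by|c» + «a|bcy» + «ac|by») + ε * «a|by|c») (ε * «a|bc|y») ((1 - ε) * («ay|b|c» + «ay|bc» + «acy|b») + ε * «ay|b|c») (ε * «ac|b|y») ((1 - ε) * («ab|c|y» + «ab|cy» + «abc|y») + ε * «ab|c|y») (ε * «a|bcy») (ε * «ay|bc») (ε * «ac|by») (ε * «acy|b») (ε * «ab|cy») ((1 - ε) * («aby|c» + «abcy») + ε * «aby|c») (ε * «abc|y») (ε * «abcy») := by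
  rw [polL₁_pendant_c]
  exact pencil_nonneg (mul_nonneg hσ (add_nonneg hH₁ hH₂)) hx h0 h1

/-- **Hanging `c` behind a cut vertex preserves (L2)** given Harris (three Harris forms of the contracted law) and `polL₂(x) ≥ 0`. [this work] -/
theorem polL₂_pendant_c_nonneg {«a|b|c|y» «a|b|cy» «a|by|c» «a|bc|y» «ay|b|c» «ac|b|y» «ab|c|y» «a|bcy» «ay|bc» «ac|by» «acy|b» «ab|cy» «aby|c» «abc|y» «abcy» ε : ℝ}
    (hσ : 0 ≤ («a|b|c|y» + «a|b|cy» + «a|by|c» + «a|bc|y» + «ay|b|c» + «ac|b|y» + «ab|c|y» + «a|bcy» + «ay|bc» + «ac|by» + «acy|b» + «ab|cy» + «aby|c» + «abc|y» + «abcy»))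
    (hH₀ : 0 ≤ Hh («a|b|c|y» + «a|b|cy» + «a|by|c» + «a|bc|y» + «ay|b|c» + «ac|b|y» + «ab|c|y» + «a|bcy» + «ay|bc» + «ac|by» + «acy|b» + «ab|cy» + «aby|c» + «abc|y» + «abcy») («a|b|c|y» + «a|b|cy» + «a|bc|y» + «ay|b|c» + «ac|b|y» + «ay|bc» + «acy|b») («a|b|c|y» + «a|by|c» + «ay|b|c» + «ab|c|y» + «aby|c») («a|b|c|y» + «ay|b|c»))
    (hH₁ : 0 ≤ Hh («a|b|c|y» + «a|b|cy» + «a|by|c» + «a|bc|y» + «ay|b|c» + «ac|b|y» + «ab|c|y» + «a|bcy» + «ay|bc» + «ac|by» + «acy|b» + «ab|cy» + «aby|c» + «abc|y» + «abcy») («a|b|c|y» + «a|b|cy» + «a|by|c» + «ay|b|c» + «ab|c|y» + «ab|cy» + «aby|c») («a|b|c|y» + «a|b|cy» + «a|bc|y» + «ay|b|c» + «ac|b|y» + «ay|bc» + «acy|b») («a|b|c|y» + «a|b|cy» + «ay|b|c»))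
    (hH₂ : 0 ≤ Hh («a|b|c|y» + «a|b|cy» + «a|by|c» + «a|bc|y» + «ay|b|c» + «ac|b|y» + «ab|c|y» + «a|bcy» + «ay|bc» + «ac|by» + «acy|b» + «ab|cy» + «aby|c» + «abc|y» + «abcy») («a|b|c|y» + «a|by|c» + «ay|b|c» + «ab|c|y» + «aby|c») («a|b|c|y» + «a|b|cy» + «a|by|c» + «a|bc|y» + «ay|b|c» + «ac|b|y» + «a|bcy» + «ay|bc» + «ac|by» + «acy|b») («a|b|c|y» + «a|by|c» + «ay|b|c»))
    (hx : 0 ≤ polL₂ «a|b|c|y» «a|b|cy» «a|by|c» «a|bc|y» «ay|b|c» «ac|b|y» «ab|c|y» «a|bcy» «ay|bc» «ac|by» «acy|b» «ab|cy» «aby|c» «abc|y» «abcy») (h0 : 0 ≤ ε) (h1 : ε ≤ 1) :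
    0 ≤ polL₂ ((1 - ε) * («a|b|c|y» + «a|b|cy» + «a|bc|y» + «ac|b|y») + ε * «a|b|c|y») (ε * «a|b|cy») ((1 - ε) * («a|by|c» + «a|bcy» + «ac|by») + ε * «a|by|c») (ε * «a|bc|y») ((1 - ε) * («ay|b|c» + «ay|bc» + «acy|b») + ε * «ay|b|c») (ε * «ac|b|y») ((1 - ε) * («ab|c|y» + «ab|cy» + «abc|y») + ε * «ab|c|y») (ε * «a|bcy») (ε * «ay|bc») (ε * «ac|by») (ε * «acy|b») (ε * «ab|cy») ((1 - ε) * («aby|c» + «abcy») + ε * «aby|c») (ε * «abc|y») (ε * «abcy») := by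
  rw [polL₂_pendant_c]
  exact pencil_nonneg (mul_nonneg hσ (add_nonneg (add_nonneg hH₀ hH₁) hH₂)) hx h0 h1

/-- **Hanging `c` behind a cut vertex preserves the hybrid row (E1)** given one Harris form and `hybE₁(x) ≥ 0`. [this work] -/
theorem hybE₁_pendant_c_nonneg {«a|b|c|y» «a|b|cy» «a|by|c» «a|bc|y» «ay|b|c» «ac|b|y» «ab|c|y» «a|bcy» «ay|bc» «ac|by» «acy|b» «ab|cy» «aby|c» «abc|y» «abcy» ε : ℝ}
    (hσ : 0 ≤ («a|b|c|y» + «a|b|cy» + «a|by|c» + «a|bc|y» + «ay|b|c» + «ac|b|y» + «ab|c|y» + «a|bcy» + «ay|bc» + «ac|by» + «acy|b» + «ab|cy» + «aby|c» + «abc|y» + «abcy»))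
    (hH₁ : 0 ≤ Hh («a|b|c|y» + «a|b|cy» + «a|by|c» + «a|bc|y» + «ay|b|c» + «ac|b|y» + «ab|c|y» + «a|bcy» + «ay|bc» + «ac|by» + «acy|b» + «ab|cy» + «aby|c» + «abc|y» + «abcy») («a|b|c|y» + «a|b|cy» + «a|by|c» + «ay|b|c» + «ab|c|y» + «ab|cy» + «aby|c») («a|b|c|y» + «a|b|cy» + «a|bc|y» + «ay|b|c» + «ac|b|y» + «ay|bc» + «acy|b») («a|b|c|y» + «a|b|cy» + «ay|b|c»))
    (hx : 0 ≤ hybE₁ «a|b|c|y» «a|b|cy» «a|by|c» «a|bc|y» «ay|b|c» «ac|b|y» «ab|c|y» «a|bcy» «ay|bc» «ac|by» «acy|b» «ab|cy» «aby|c» «abc|y» «abcy») (h0 : 0 ≤ ε) (h1 : ε ≤ 1) :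
    0 ≤ hybE₁ ((1 - ε) * («a|b|c|y» + «a|b|cy» + «a|bc|y» + «ac|b|y») + ε * «a|b|c|y») (ε * «a|b|cy») ((1 - ε) * («a|by|c» + «a|bcy» + «ac|by») + ε * «a|by|c») (ε * «a|bc|y») ((1 - ε) * («ay|b|c» + «ay|bc» + «acy|b») + ε * «ay|b|c») (ε * «ac|b|y») ((1 - ε) * («ab|c|y» + «ab|cy» + «abc|y») + ε * «ab|c|y») (ε * «a|bcy») (ε * «ay|bc») (ε * «ac|by») (ε * «acy|b») (ε * «ab|cy») ((1 - ε) * («aby|c» + «abcy») + ε * «aby|c») (ε * «abc|y») (ε * «abcy») := by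
  rw [hybE₁_pendant_c]
  exact pencil_nonneg (mul_nonneg hσ hH₁) hx h0 h1

/-- **Hanging `b` behind a cut vertex preserves (L1)** given Harris (mirror statement). [this work] -/
theorem polL₁_pendant_b_nonneg {«a|b|c|y» «a|b|cy» «a|by|c» «a|bc|y» «ay|b|c» «ac|b|y» «ab|c|y» «a|bcy» «ay|bc» «ac|by» «acy|b» «ab|cy» «aby|c» «abc|y» «abcy» ε : ℝ}
    (hσ : 0 ≤ («a|b|c|y» + «a|b|cy» + «a|by|c» + «a|bc|y» + «ay|b|c» + «ac|b|y» + «ab|c|y» + «a|bcy» + «ay|bc» + «ac|by» + «acy|b» + «ab|cy» + «aby|c» + «abc|y» + «abcy»))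
    (hH₁ : 0 ≤ Hh («a|b|c|y» + «a|b|cy» + «a|by|c» + «a|bc|y» + «ay|b|c» + «ac|b|y» + «ab|c|y» + «a|bcy» + «ay|bc» + «ac|by» + «acy|b» + «ab|cy» + «aby|c» + «abc|y» + «abcy») («a|b|c|y» + «a|b|cy» + «a|by|c» + «ay|b|c» + «ac|b|y» + «ac|by» + «acy|b») («a|b|c|y» + «a|by|c» + «a|bc|y» + «ay|b|c» + «ab|c|y» + «ay|bc» + «aby|c») («a|b|c|y» + «a|by|c» + «ay|b|c»))
    (hH₂ : 0 ≤ Hh («a|b|c|y» + «a|b|cy» + «a|by|c» + «a|bc|y» + «ay|b|c» + «ac|b|y» + «ab|c|y» + «a|bcy» + «ay|bc» + «ac|by» + «acy|b» + «ab|cy» + «aby|c» + «abc|y» + «abcy») («a|b|c|y» + «a|b|cy» + «ay|b|c» + «ac|b|y» + «acy|b») («a|b|c|y» + «a|b|cy» + «a|by|c» + «a|bc|y» + «ay|b|c» + «ab|c|y» + «a|bcy» + «ay|bc» + «ab|cy» + «aby|c») («a|b|c|y» + «a|b|cy» + «ay|b|c»))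
    (hx : 0 ≤ polL₁ «a|b|c|y» «a|b|cy» «a|by|c» «a|bc|y» «ay|b|c» «ac|b|y» «ab|c|y» «a|bcy» «ay|bc» «ac|by» «acy|b» «ab|cy» «aby|c» «abc|y» «abcy») (h0 : 0 ≤ ε) (h1 : ε ≤ 1) :
    0 ≤ polL₁ ((1 - ε) * («a|b|c|y» + «a|by|c» + «a|bc|y» + «ab|c|y») + ε * «a|b|c|y») ((1 - ε) * («a|b|cy» + «a|bcy» + «ab|cy») + ε * «a|b|cy») (ε * «a|by|c») (ε * «a|bc|y») ((1 - ε) * («ay|b|c» + «ay|bc» + «aby|c») + ε * «ay|b|c») ((1 - ε) * («ac|b|y» + «ac|by» + «abc|y») + ε * «ac|b|y») (ε * «ab|c|y») (ε * «a|bcy») (ε * «ay|bc») (ε * «ac|by») ((1 - ε) * («acy|b» + «abcy») + ε * «acy|b») (ε * «ab|cy») (ε * «aby|c») (ε * «abc|y») (ε * «abcy») := by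
  rw [polL₁_pendant_b]
  exact pencil_nonneg (mul_nonneg hσ (add_nonneg hH₁ hH₂)) hx h0 h1

end CubicFourPoint

end Summit.CriticalPhenomena.PercolationContinuityZ3.Theorems
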